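import Summits.RiemannHypothesis.RiemannHypothesis.Theorems.GroundBartaPolarPerronFrobeniusSmoothAbs
import Summits.RiemannHypothesis.RiemannHypothesis.Theorems.GroundBartaPolarPerronFrobeniusPolarLoss
import Literature.NumberTheory.LFunctions.WeilWindowSuzukiProofs
import HarnessLib

/-!
# RiemannHypothesis / GroundBarta — crux `PolarPerronFrobenius` (stmt-RiemannHypothesis-18390):
# the SIGN-IMPROVING inequality of the windowed Weil form at small windows (part 2b/3)

Helper file (`--supports`), RH-free, Mathlib + proved tree files only, no definitions.

**Mechanism (Perron–Frobenius survives the polar term at small windows).**  By the Markov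
decomposition of the windowed Weil form (Bombieri 2000 Thm 2; tree file `WeilMarkovQuadratic`),
`Re Q(g) = P(g) + 𝓔_a(g) − M_a‖g‖₂²` with the pole form `P(g) = 2|∫g cosh(t/2)|² − 2|∫ g sinh(t/2)|²`,
the pure-jump Dirichlet form `𝓔_a(g) = Σ_{log n<2a} Λ(n)n^{-1/2} D_{log n}(g) + ∫₀^∞ w(t) D_t(g) dt`
(`D_t(g) = ∫|g(x+t) − g(x)|²`, `w(t) = e^{t/2}/(2 sinh t)`) and a constant `M_a`.  For a real test
`f = f⁺ − f⁻` on `[-a, a]`, replacing `f` by `|f| = f⁺ + f⁻`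
* LOWERS the Dirichlet energy by at least `4 w(2a) ∫f⁺ ∫f⁻` (Beurling–Deny: `D_t(|f|) ≤ D_t(f)`,
  and `∫₀^{2a} (D_t(f) − D_t(|f|)) dt = (∫|f|)² − (∫f)² = 4∫f⁺∫f⁻` by `∫₀^{2a} D_t(g) dt = 4a‖g‖² − |∫g|²`,
  `w ≥ w(2a)` on `(0, 2a]`), and
* RAISES the pole form by at most `8(C⁺C⁻ − S⁺S⁻) ≤ 8 cosh(a) ∫f⁺ ∫f⁻`
  (`C^± = ∫ f^± cosh(t/2) ≤ cosh(a/2)∫f^±`, `|S^±| ≤ sinh(a/2)∫f^±`).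
So `Re Q(|f|) ≤ Re Q(f)` as soon as `2 cosh a ≤ w(2a)`, i.e. `4 cosh(a) sinh(2a) ≤ e^{a}`, which holds
for `0 < a ≤ 1/10` (sharp threshold of the pointwise kernel comparison
`2cosh(r/2) ≤ w(r)` on `(0, 2a]`: `a ≤ 0.1406…`).  Since `|f|` is only Lipschitz, everything is run on
the smooth approximants `w_η = ψ_η ∘ f` of part 1 (`…SmoothAbs.lean`), the `η`-free polar/mass bookkeeping
is part 2a (`…PolarLoss.lean`), and the limit `η → 0⁺` is taken
in the resulting inequality: the output (`sw_exists_nonneg_test_lt`) is, for every `δ > 0`, a smooth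
NON-NEGATIVE test `w` with `tsupport w ⊆ tsupport f` and `Re Q(w) < ‖w‖₂² (Re Q(f) + δ)`.

References: E. Bombieri, Rend. Lincei (9) 11 (2000) Thm 2; A. Beurling, J. Deny, Acta Math. 99
(1958); Z.-Q. Chen, M. Fukushima (2012) §1.1; M. Suzuki, arXiv:2606.09096 (2026) §5.2 (the same
inequality `𝓛(|v|) ≤ 𝓛(v)` for the scale-free LIMIT form; here for `Q_a` itself at a fixed window).
Prover B, speedrun unit `sr-gb-rung-b`.
-/

set_option linter.dupNamespace false

noncomputable section

open Set MeasureTheory Filter Complex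
open scoped Real Topology

namespace Summit.RiemannHypothesis.RiemannHypothesis.Theorems.PolarPerronFrobenius

open Literature.NumberTheory.LFunctions

/-! ## The Dirichlet gain survives on the smooth approximants -/

section Energy

variable {f : ℝ → ℝ} {a η : ℝ}

/-- **Energy comparison for the approximants**: for `η > 0` and `f` a real test on `[-a, a]`,
`𝓔_a(w_η) − 𝓔_a(f) ≤ w(2a) · (∫₀^{2a} D_t(w_η) dt − ∫₀^{2a} D_t(f) dt)`
(prime part and `t > 2a` part: `≤ 0` by the contraction property and `‖w_η‖₂ ≤ ‖f‖₂`; on `(0, 2a]`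
use `w(t) ≥ w(2a)` against the non-positive integrand `D_t(w_η) − D_t(f)`). [folklore] -/
theorem sw_weilDirichletEnergy_psi_sub_le (hf : ContDiff ℝ (⊤ : ℕ∞) f) (hfs : HasCompactSupport f)
    (ha : 0 < a) (hsupp : tsupport f ⊆ Icc (-a) a) (hη : 0 < η) :
    weilDirichletEnergy a (fun t => ((Real.sqrt (f t ^ 2 + η ^ 2) - η : ℝ) : ℂ)) -
        weilDirichletEnergy a (fun t => ((f t : ℝ) : ℂ)) ≤
      weilArchDensity (2 * a) *
        ((∫ t in (0 : ℝ)..(2 * a), weilIncrement (fun t => ((Real.sqrt (f t ^ 2 + η ^ 2) - η : ℝ) : ℂ)) t) -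
          ∫ t in (0 : ℝ)..(2 * a), weilIncrement (fun t => ((f t : ℝ) : ℂ)) t) := by
  set W : ℝ → ℂ := fun t => ((Real.sqrt (f t ^ 2 + η ^ 2) - η : ℝ) : ℂ) with hWdef
  set F : ℝ → ℂ := fun t => ((f t : ℝ) : ℂ) with hFdef
  have hF : IsWeilTest F := sw_isWeilTest_ofReal_comp hf hfs
  have hW : IsWeilTest W := sw_isWeilTest_psi_comp hf hfs hη
  have hFs : tsupport F ⊆ Icc (-a) a := (sw_tsupport_ofReal_comp f).symm ▸ hsupp
  have hWs : tsupport W ⊆ Icc (-a) a := (sw_tsupport_psi_comp_subset hη.le).trans hsupp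
  have hD : ∀ t, weilIncrement W t ≤ weilIncrement F t := sw_weilIncrement_psi_comp_le hf hfs η
  have hN : ∫ t, ‖W t‖ ^ 2 ≤ ∫ t, ‖F t‖ ^ 2 := sw_integral_norm_sq_psi_comp_le hf hfs hη.le
  -- prime part
  have hsum : ∑ n ∈ weilPrimeIndex a, (ArithmeticFunction.vonMangoldt n : ℝ) / Real.sqrt n *
        weilIncrement W (Real.log n) ≤
      ∑ n ∈ weilPrimeIndex a, (ArithmeticFunction.vonMangoldt n : ℝ) / Real.sqrt n *
        weilIncrement F (Real.log n) :=
    Finset.sum_le_sum fun n _ => mul_le_mul_of_nonneg_left (hD _)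
      (div_nonneg ArithmeticFunction.vonMangoldt_nonneg (Real.sqrt_nonneg _))
  -- archimedean part
  have hIW := integrableOn_weilArchDensity_mul_weilIncrement hW
  have hIF := integrableOn_weilArchDensity_mul_weilIncrement hF
  have hG : IntegrableOn (fun t => weilArchDensity t * weilIncrement W t -
      weilArchDensity t * weilIncrement F t) (Ioi 0) := hIW.sub hIF
  have hunion : Ioc 0 (2 * a) ∪ Ioi (2 * a) = Ioi 0 := Ioc_union_Ioi_eq_Ioi (by linarith)
  have hsplit : ∫ t in Ioi 0, (weilArchDensity t * weilIncrement W t -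
        weilArchDensity t * weilIncrement F t) =
      (∫ t in Ioc 0 (2 * a), (weilArchDensity t * weilIncrement W t -
          weilArchDensity t * weilIncrement F t)) +
        ∫ t in Ioi (2 * a), (weilArchDensity t * weilIncrement W t -
          weilArchDensity t * weilIncrement F t) := by
    rw [← hunion, setIntegral_union Ioc_disjoint_Ioi_same measurableSet_Ioi
      (hG.mono_set Ioc_subset_Ioi_self) (hG.mono_set (Ioi_subset_Ioi (by linarith)))]
  -- beyond `2a` the integrand is `2 w(t) (‖W‖² − ‖F‖²) ≤ 0`
  have htail : ∫ t in Ioi (2 * a), (weilArchDensity t * weilIncrement W t -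
      weilArchDensity t * weilIncrement F t) ≤ 0 := by
    refine setIntegral_nonpos measurableSet_Ioi fun t ht => ?_
    have ht' : 2 * a ≤ |t| := by
      rw [abs_of_pos (by linarith [mem_Ioi.1 ht])]
      exact (mem_Ioi.1 ht).le
    rw [weilIncrement_eq_of_le_abs hW hWs ht', weilIncrement_eq_of_le_abs hF hFs ht', ← mul_sub]
    exact mul_nonpos_of_nonneg_of_nonpos (weilArchDensity_pos (by linarith [mem_Ioi.1 ht])).le
      (by linarith)
  -- on `(0, 2a]` freeze the density at `w(2a)`
  have hcW : Continuous (weilIncrement W) := continuous_weilIncrement hW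
  have hcF : Continuous (weilIncrement F) := continuous_weilIncrement hF
  have hIoc : ∫ t in Ioc 0 (2 * a), (weilArchDensity t * weilIncrement W t -
        weilArchDensity t * weilIncrement F t) ≤
      ∫ t in Ioc 0 (2 * a), (weilArchDensity (2 * a) * weilIncrement W t -
        weilArchDensity (2 * a) * weilIncrement F t) := by
    refine setIntegral_mono_on (hG.mono_set Ioc_subset_Ioi_self)
      (((continuous_const.mul hcW).sub (continuous_const.mul hcF)).integrableOn_Ioc)
      measurableSet_Ioc fun t ht => ?_
    rw [← mul_sub, ← mul_sub]
    have hw : weilArchDensity (2 * a) ≤ weilArchDensity t :=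
      weilArchDensity_antitoneOn (mem_Ioi.2 ht.1) (mem_Ioi.2 (by linarith)) ht.2
    exact mul_le_mul_of_nonpos_right hw (by linarith [hD t])
  have hIoc' : ∫ t in Ioc 0 (2 * a), (weilArchDensity (2 * a) * weilIncrement W t -
        weilArchDensity (2 * a) * weilIncrement F t) =
      weilArchDensity (2 * a) * ((∫ t in (0 : ℝ)..(2 * a), weilIncrement W t) -
        ∫ t in (0 : ℝ)..(2 * a), weilIncrement F t) := by
    rw [intervalIntegral.integral_of_le (by linarith), intervalIntegral.integral_of_le (by linarith),
      integral_sub (hcW.integrableOn_Ioc.const_mul _) (hcF.integrableOn_Ioc.const_mul _),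
      integral_const_mul, integral_const_mul, mul_sub]
  have harch : (∫ t in Ioi 0, weilArchDensity t * weilIncrement W t) -
      (∫ t in Ioi 0, weilArchDensity t * weilIncrement F t) ≤
      weilArchDensity (2 * a) * ((∫ t in (0 : ℝ)..(2 * a), weilIncrement W t) -
        ∫ t in (0 : ℝ)..(2 * a), weilIncrement F t) := by
    rw [← integral_sub hIW hIF, hsplit, ← hIoc']
    linarith
  unfold weilDirichletEnergy
  linarith

/-- **The comparison inequality for the approximants** (per `η > 0`): with `N = ‖·‖₂²`,
`Re Q(w_η) − Re Q(f) ≤ [P(w_η) − P(f)] + w(2a)[(4aN(w_η) − |∫w_η|²) − (4aN(f) − |∫f|²)] − M_a (N(w_η) − N(f))`.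
[folklore] -/
theorem sw_re_weilQuadratic_psi_sub_le (hf : ContDiff ℝ (⊤ : ℕ∞) f) (hfs : HasCompactSupport f)
    (ha : 0 < a) (hsupp : tsupport f ⊆ Icc (-a) a) (hη : 0 < η) :
    (weilQuadratic (fun t => ((Real.sqrt (f t ^ 2 + η ^ 2) - η : ℝ) : ℂ))).re -
        (weilQuadratic (fun t => ((f t : ℝ) : ℂ))).re ≤
      (weilPoleForm (fun t => ((Real.sqrt (f t ^ 2 + η ^ 2) - η : ℝ) : ℂ)) -
          weilPoleForm (fun t => ((f t : ℝ) : ℂ))) +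
        weilArchDensity (2 * a) *
          ((4 * a * (∫ t, ‖((Real.sqrt (f t ^ 2 + η ^ 2) - η : ℝ) : ℂ)‖ ^ 2) -
              ‖∫ t, ((Real.sqrt (f t ^ 2 + η ^ 2) - η : ℝ) : ℂ)‖ ^ 2) -
            (4 * a * (∫ t, ‖((f t : ℝ) : ℂ)‖ ^ 2) - ‖∫ t, ((f t : ℝ) : ℂ)‖ ^ 2)) -
        weilMarkovConstant a *
          ((∫ t, ‖((Real.sqrt (f t ^ 2 + η ^ 2) - η : ℝ) : ℂ)‖ ^ 2) - ∫ t, ‖((f t : ℝ) : ℂ)‖ ^ 2) := by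
  set W : ℝ → ℂ := fun t => ((Real.sqrt (f t ^ 2 + η ^ 2) - η : ℝ) : ℂ) with hWdef
  set F : ℝ → ℂ := fun t => ((f t : ℝ) : ℂ) with hFdef
  have hF : IsWeilTest F := sw_isWeilTest_ofReal_comp hf hfs
  have hW : IsWeilTest W := sw_isWeilTest_psi_comp hf hfs hη
  have hFs : tsupport F ⊆ Icc (-a) a := (sw_tsupport_ofReal_comp f).symm ▸ hsupp
  have hWs : tsupport W ⊆ Icc (-a) a := (sw_tsupport_psi_comp_subset hη.le).trans hsupp
  have hE := sw_weilDirichletEnergy_psi_sub_le hf hfs ha hsupp hη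
  rw [intervalIntegral_weilIncrement hW (by linarith) hWs,
    intervalIntegral_weilIncrement hF (by linarith) hFs] at hE
  rw [weilQuadratic_re_eq_weilPoleForm_add_weilDirichletEnergy_sub hW hWs,
    weilQuadratic_re_eq_weilPoleForm_add_weilDirichletEnergy_sub hF hFs]
  linarith

end Energy

/-! ## The limit `η → 0⁺`: a non-negative test below `Re Q(f) + δ` -/

section Main

variable {f : ℝ → ℝ} {a : ℝ}

/-- The pole form of the approximants converges: `P(w_η) → P(|f|)` as `η → 0⁺`. [folklore] -/
theorem sw_tendsto_weilPoleForm_psi (hfc : Continuous f) (hsupp : Function.support f ⊆ Icc (-a) a) :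
    Tendsto (fun η : ℝ => weilPoleForm (fun t => ((Real.sqrt (f t ^ 2 + η ^ 2) - η : ℝ) : ℂ)))
      (𝓝[>] 0) (𝓝 (weilPoleForm (fun t => ((|f t| : ℝ) : ℂ)))) := by
  have hcosh : Continuous fun t : ℝ => (Real.cosh (t / 2) : ℂ) :=
    Complex.continuous_ofReal.comp (Real.continuous_cosh.comp (continuous_id.div_const 2))
  have hsinh : Continuous fun t : ℝ => (Real.sinh (t / 2) : ℂ) :=
    Complex.continuous_ofReal.comp (Real.continuous_sinh.comp (continuous_id.div_const 2))
  have h1 := sw_tendsto_integral_psi_mul hfc hsupp hcosh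
  have h2 := sw_tendsto_integral_psi_mul hfc hsupp hsinh
  unfold weilPoleForm
  exact ((h1.norm.pow 2).const_mul 2).sub ((h2.norm.pow 2).const_mul 2)

/-- The total mass of the approximants converges: `∫ w_η → ∫ |f|` as `η → 0⁺`. [folklore] -/
theorem sw_tendsto_integral_psi (hfc : Continuous f) (hsupp : Function.support f ⊆ Icc (-a) a) :
    Tendsto (fun η : ℝ => ∫ t, ((Real.sqrt (f t ^ 2 + η ^ 2) - η : ℝ) : ℂ)) (𝓝[>] 0)
      (𝓝 (∫ t, ((|f t| : ℝ) : ℂ))) := by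
  have h := sw_tendsto_integral_psi_mul hfc hsupp (φ := fun _ => (1 : ℂ)) continuous_const
  simp only [mul_one] at h
  exact h

/-- **Main lemma (sign improvement at small windows, test level).**  Let `0 < a ≤ 1/10` and let `f`
be a real smooth function with `tsupport f ⊆ [-a, a]` and `‖f‖₂ = 1`.  For every `δ > 0` some
approximant `w_η = ψ_η ∘ f` (`η > 0`; smooth, NON-NEGATIVE, `tsupport w_η ⊆ tsupport f`) has
`‖w_η‖₂ > 0` and `Re Q(w_η) < ‖w_η‖₂² (Re Q(f) + δ)`: non-negative tests come within every `δ` of the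
Rayleigh quotient of `f`.  (Beurling–Deny gain `4w(2a)∫f⁺∫f⁻` of the Markov part against the polar loss
`≤ 8cosh(a)∫f⁺∫f⁻`, and `2cosh a ≤ w(2a)`.) [folklore] -/
theorem sw_exists_nonneg_test_lt (hf : ContDiff ℝ (⊤ : ℕ∞) f) (hfs : HasCompactSupport f)
    (ha : 0 < a) (ha' : a ≤ 1 / 10) (hsupp : tsupport f ⊆ Icc (-a) a)
    (hnorm : ∫ t, ‖((f t : ℝ) : ℂ)‖ ^ 2 = 1) {δ : ℝ} (hδ : 0 < δ) :
    ∃ η : ℝ, 0 < η ∧ 0 < ∫ t, ‖((Real.sqrt (f t ^ 2 + η ^ 2) - η : ℝ) : ℂ)‖ ^ 2 ∧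
      (weilQuadratic (fun t => ((Real.sqrt (f t ^ 2 + η ^ 2) - η : ℝ) : ℂ))).re <
        (∫ t, ‖((Real.sqrt (f t ^ 2 + η ^ 2) - η : ℝ) : ℂ)‖ ^ 2) *
          ((weilQuadratic (fun t => ((f t : ℝ) : ℂ))).re + δ) := by
  have hfc : Continuous f := hf.continuous
  have hsupp' : Function.support f ⊆ Icc (-a) a := (subset_tsupport f).trans hsupp
  -- notation for the `η`-dependent quantities
  set QF : ℝ := (weilQuadratic (fun t => ((f t : ℝ) : ℂ))).re with hQF
  set PF : ℝ := weilPoleForm (fun t => ((f t : ℝ) : ℂ)) with hPF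
  set PA : ℝ := weilPoleForm (fun t => ((|f t| : ℝ) : ℂ)) with hPA
  set IF : ℂ := ∫ t, ((f t : ℝ) : ℂ) with hIF
  set IA : ℂ := ∫ t, ((|f t| : ℝ) : ℂ) with hIA
  set w2 : ℝ := weilArchDensity (2 * a) with hw2
  set M : ℝ := weilMarkovConstant a with hM
  set Nw : ℝ → ℝ := fun η => ∫ t, ‖((Real.sqrt (f t ^ 2 + η ^ 2) - η : ℝ) : ℂ)‖ ^ 2 with hNw
  set Pw : ℝ → ℝ := fun η => weilPoleForm (fun t => ((Real.sqrt (f t ^ 2 + η ^ 2) - η : ℝ) : ℂ))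
    with hPw
  set Iw : ℝ → ℂ := fun η => ∫ t, ((Real.sqrt (f t ^ 2 + η ^ 2) - η : ℝ) : ℂ) with hIw
  set U : ℝ → ℝ := fun η => QF + (Pw η - PF) +
      w2 * ((4 * a * Nw η - ‖Iw η‖ ^ 2) - (4 * a * 1 - ‖IF‖ ^ 2)) - M * (Nw η - 1) -
      Nw η * (QF + δ) with hU
  -- (1) the per-`η` inequality
  have hUle : ∀ η : ℝ, 0 < η →
      (weilQuadratic (fun t => ((Real.sqrt (f t ^ 2 + η ^ 2) - η : ℝ) : ℂ))).re - Nw η * (QF + δ) ≤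
        U η := by
    intro η hη
    have h := sw_re_weilQuadratic_psi_sub_le hf hfs ha hsupp hη
    rw [hnorm] at h
    simp only [hU, hNw, hPw, hIw, hQF, hPF, hIF, hw2, hM]
    linarith
  -- (2) the limit of `U`
  have hN : Tendsto Nw (𝓝[>] 0) (𝓝 1) := by
    have h := sw_tendsto_integral_norm_sq_psi hfc hfs
    rwa [hnorm] at h
  have hP : Tendsto Pw (𝓝[>] 0) (𝓝 PA) := sw_tendsto_weilPoleForm_psi hfc hsupp'
  have hI : Tendsto Iw (𝓝[>] 0) (𝓝 IA) := sw_tendsto_integral_psi hfc hsupp'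
  set U0 : ℝ := QF + (PA - PF) + w2 * ((4 * a * 1 - ‖IA‖ ^ 2) - (4 * a * 1 - ‖IF‖ ^ 2)) -
      M * (1 - 1) - 1 * (QF + δ) with hU0
  have hUlim : Tendsto U (𝓝[>] 0) (𝓝 U0) := by
    have t1 : Tendsto (fun η => QF + (Pw η - PF)) (𝓝[>] 0) (𝓝 (QF + (PA - PF))) :=
      tendsto_const_nhds.add (hP.sub tendsto_const_nhds)
    have t2 : Tendsto (fun η => w2 * ((4 * a * Nw η - ‖Iw η‖ ^ 2) - (4 * a * 1 - ‖IF‖ ^ 2)))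
        (𝓝[>] 0) (𝓝 (w2 * ((4 * a * 1 - ‖IA‖ ^ 2) - (4 * a * 1 - ‖IF‖ ^ 2)))) :=
      (((hN.const_mul (4 * a)).sub (hI.norm.pow 2)).sub tendsto_const_nhds).const_mul w2
    have t3 : Tendsto (fun η => M * (Nw η - 1)) (𝓝[>] 0) (𝓝 (M * (1 - 1))) :=
      (hN.sub tendsto_const_nhds).const_mul M
    have t4 : Tendsto (fun η => Nw η * (QF + δ)) (𝓝[>] 0) (𝓝 (1 * (QF + δ))) :=
      hN.mul tendsto_const_nhds
    rw [hU, hU0]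
    exact ((t1.add t2).sub t3).sub t4
  -- (3) the limit is negative: polar loss ≤ Dirichlet gain
  have hgain : PA - PF ≤ w2 * (‖IA‖ ^ 2 - ‖IF‖ ^ 2) := by
    have h1 := sw_weilPoleForm_abs_sub_le hfc hfs ha.le hsupp'
    have h2 := sw_norm_sq_integral_abs_sub_eq hfc hfs
    have h3 := sw_two_cosh_le_weilArchDensity ha ha'
    have hPp0 : 0 ≤ ∫ t, max (f t) 0 := integral_nonneg fun t => le_max_right _ _
    have hNn0 : 0 ≤ ∫ t, max (-f t) 0 := integral_nonneg fun t => le_max_right _ _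
    have h4 : 2 * Real.cosh a * ((∫ t, max (f t) 0) * ∫ t, max (-f t) 0) ≤
        weilArchDensity (2 * a) * ((∫ t, max (f t) 0) * ∫ t, max (-f t) 0) :=
      mul_le_mul_of_nonneg_right h3 (mul_nonneg hPp0 hNn0)
    simp only [hPA, hPF, hIA, hIF, hw2]
    rw [h2]
    linarith
  have hU0neg : U0 < 0 := by
    simp only [hU0]
    linarith
  -- (4) pick `η`
  have hev1 : ∀ᶠ η in 𝓝[>] (0 : ℝ), U η < 0 := (tendsto_order.1 hUlim).2 _ hU0neg
  have hev2 : ∀ᶠ η in 𝓝[>] (0 : ℝ), 1 / 2 < Nw η := (tendsto_order.1 hN).1 _ (by norm_num)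
  have hev3 : ∀ᶠ η in 𝓝[>] (0 : ℝ), 0 < η := self_mem_nhdsWithin
  obtain ⟨η, hη1, hη2, hη3⟩ := (hev1.and (hev2.and hev3)).exists
  refine ⟨η, hη3, by simp only [hNw] at hη2; linarith, ?_⟩
  have h := hUle η hη3
  simp only [hNw] at h hη2 ⊢
  linarith

end Main

end Summit.RiemannHypothesis.RiemannHypothesis.Theorems.PolarPerronFrobenius

end
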